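import Literature.Dynamics.NBody.AlbouyKaloshin2012SymmetricCCs34
import Mathlib.Analysis.Convex.Deriv
import Mathlib.Analysis.Calculus.Deriv.Inv
import Mathlib.Tactic
import HarnessLib

/-!
# Moulton (1910): finitely many collinear central configurations — the uniqueness-per-ordering half

Topic `Literature/Dynamics/NBody`; `pub-smale6` cell, seat 1 gen 3. [Moulton1910] proves that `n` positive masses
admit exactly `n!/2` collinear central configurations up to similarity, one for each ordering of the bodies on
the line up to reversal. We formalise the half that gives FINITENESS, in the normalization of [AlbouyKaloshin2012]
Definition 1 (multiplier `1`, so no quotient is taken): writing `x_k` for the abscissae, a collinear normalized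
central configuration solves `x_k = Σ_l m_l (x_k − x_l)/|x_k − x_l|³` (`IsCollinearCC`), and

* `moulton_unique` — two solutions with the same ordering of the bodies coincide. Proof (Moulton's, in the
  convexity form popularised by Smale / Moeckel): along the segment `z(t) = x + t(y − x)`, `t ∈ [0,1]`, the ordering
  is constant, the function `G(t) = Σ_k m_k z_k²/2 + ½ Σ_{k≠l} m_k m_l/|z_k − z_l|` is strictly convex, and its
  derivative vanishes at `t = 0` and `t = 1` because `x` and `y` solve the equations — impossible for a strictly
  convex function unless `x = y` (`StrictConvexOn.lt_slope_of_hasDerivAt` / `slope_lt_of_hasDerivAt`);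
* `collinearCCs_finite` — hence the solutions inject into the finite set of orderings and are finite in number;
* `collinear_positiveNormalizedCCs_finite` — the planar positive normalized central configurations of
  [AlbouyKaloshin2012] Definition 1 with all bodies on the `x`-axis are finite in number (positive masses). This
  discharges the Moulton hypothesis of `AlbouyKaloshin2012SymmetricCCsAll.lean`.
-/

namespace Literature.Dynamics.NBody

open Finset Set

variable {n : ℕ}

/-- The right-hand side of the collinear central-configuration equations in the normalization of
[AlbouyKaloshin2012] Definition 1: `F_k(x) = Σ_l m_l (x_k − x_l)/|x_k − x_l|³` (the diagonal term is `0/0 = 0`).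
[cite: Moulton1910, §2] -/
noncomputable def collForce (m x : Fin n → ℝ) (k : Fin n) : ℝ :=
  ∑ l, m l * (x k - x l) / |x k - x l| ^ 3

/-- A collinear normalized central configuration: pairwise distinct abscissae solving `x_k = F_k(x)`.
[cite: Moulton1910, §2] -/
def IsCollinearCC (m x : Fin n → ℝ) : Prop :=
  (∀ k l, k ≠ l → x k ≠ x l) ∧ ∀ k, x k = collForce m x k

/-- Convexity of `t ↦ c/(a p + b r)`-type expressions: for `p, r > 0`, `c ≥ 0`, `a, b ≥ 0`, `a + b = 1`,
`c/(a p + b r) ≤ a (c/p) + b (c/r)`. [folklore] -/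
theorem div_convex_comb_le {c p r a b : ℝ} (hc : 0 ≤ c) (hp : 0 < p) (hr : 0 < r) (ha : 0 ≤ a)
    (hb : 0 ≤ b) (hab : a + b = 1) : c / (a * p + b * r) ≤ a * (c / p) + b * (c / r) := by
  obtain rfl : b = 1 - a := by linarith
  have hden : 0 < a * p + (1 - a) * r := by
    rcases le_total r p with h | h
    · nlinarith [mul_nonneg ha (sub_nonneg.mpr h)]
    · nlinarith [mul_nonneg hb (sub_nonneg.mpr h)]
  rw [div_le_iff₀ hden]
  have key : (a * (c / p) + (1 - a) * (c / r)) * (a * p + (1 - a) * r) - c =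
      c * (a * (1 - a) * (p - r) ^ 2 / (p * r)) := by
    field_simp
    ring
  have hnonneg : 0 ≤ c * (a * (1 - a) * (p - r) ^ 2 / (p * r)) := by
    apply mul_nonneg hc
    apply div_nonneg _ (by positivity)
    have : 0 ≤ a * (1 - a) := mul_nonneg ha hb
    positivity
  linarith

/-- **Moulton's uniqueness.** Two collinear normalized central configurations of positive masses with the same
ordering of the bodies are equal. [cite: Moulton1910, §§3–5] -/
theorem moulton_unique {m x y : Fin n → ℝ} (hm : ∀ k, 0 < m k) (hx : IsCollinearCC m x)
    (hy : IsCollinearCC m y) (hord : ∀ k l, x k < x l ↔ y k < y l) : x = y := by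
  by_contra hne
  -- direction and signs
  set w : Fin n → ℝ := fun k => y k - x k with hw
  set σ : Fin n → Fin n → ℝ := fun k l => if x l < x k then 1 else -1 with hσ
  have hσsq : ∀ k l, σ k l ^ 2 = 1 := by
    intro k l; simp only [hσ]; split_ifs <;> norm_num
  have hσanti : ∀ k l, k ≠ l → σ l k = -σ k l := by
    intro k l hkl
    have hxne : x k ≠ x l := hx.1 k l hkl
    simp only [hσ]
    rcases lt_or_gt_of_ne hxne with h | h
    · rw [if_pos h, if_neg (not_lt.mpr h.le)]; norm_num
    · rw [if_neg (not_lt.mpr h.le), if_pos h]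
  -- positivity of σ_{kl} (x_k - x_l) and σ_{kl} (y_k - y_l)
  have hdx : ∀ k l, k ≠ l → 0 < σ k l * (x k - x l) := by
    intro k l hkl
    have hxne : x k ≠ x l := hx.1 k l hkl
    simp only [hσ]
    split_ifs with h
    · linarith
    · have : x k < x l := lt_of_le_of_ne (not_lt.mp h) hxne
      linarith
  have hdy : ∀ k l, k ≠ l → 0 < σ k l * (y k - y l) := by
    intro k l hkl
    have hxne : x k ≠ x l := hx.1 k l hkl
    simp only [hσ]
    split_ifs with h
    · have : y l < y k := (hord l k).mp h
      linarith
    · have hxl : x k < x l := lt_of_le_of_ne (not_lt.mp h) hxne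
      have : y k < y l := (hord k l).mp hxl
      linarith
  -- the segment z(t) = x + t w and positivity of the denominators on [0,1]
  have hden : ∀ t ∈ Icc (0:ℝ) 1, ∀ k l, k ≠ l →
      0 < σ k l * ((x k + t * w k) - (x l + t * w l)) := by
    intro t ht k l hkl
    have h1 := hdx k l hkl
    have h2 := hdy k l hkl
    have : σ k l * ((x k + t * w k) - (x l + t * w l)) =
        (1 - t) * (σ k l * (x k - x l)) + t * (σ k l * (y k - y l)) := by
      simp only [hw]; ring
    rw [this]
    rcases le_total (σ k l * (x k - x l)) (σ k l * (y k - y l)) with h | h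
    · nlinarith [ht.1, ht.2]
    · nlinarith [ht.1, ht.2]
  -- the convex function G and its derivative
  set G : ℝ → ℝ := fun t => (∑ k, m k / 2 * ((x k + t * w k) * (x k + t * w k))) +
      1 / 2 * ∑ k, ∑ l, m k * m l / (σ k l * ((x k + t * w k) - (x l + t * w l))) with hG
  set G' : ℝ → ℝ := fun t => (∑ k, m k / 2 * (w k * (x k + t * w k) + (x k + t * w k) * w k)) +
      1 / 2 * ∑ k, ∑ l, -(m k * m l * (σ k l * (w k - w l))) /
        (σ k l * ((x k + t * w k) - (x l + t * w l))) ^ 2 with hG'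
  have hderiv : ∀ t ∈ Icc (0:ℝ) 1, HasDerivAt G (G' t) t := by
    intro t ht
    have hz : ∀ k, HasDerivAt (fun s => x k + s * w k) (w k) t := by
      intro k
      simpa using ((hasDerivAt_id t).mul_const (w k)).const_add (x k)
    have hA : HasDerivAt (fun s => ∑ k, m k / 2 * ((x k + s * w k) * (x k + s * w k)))
        (∑ k, m k / 2 * (w k * (x k + t * w k) + (x k + t * w k) * w k)) t := by
      apply HasDerivAt.fun_sum
      intro k _
      exact ((hz k).mul (hz k)).const_mul (m k / 2)
    have hB : HasDerivAt (fun s => ∑ k, ∑ l, m k * m l / (σ k l * ((x k + s * w k) - (x l + s * w l))))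
        (∑ k, ∑ l, -(m k * m l * (σ k l * (w k - w l))) /
          (σ k l * ((x k + t * w k) - (x l + t * w l))) ^ 2) t := by
      apply HasDerivAt.fun_sum
      intro k _
      apply HasDerivAt.fun_sum
      intro l _
      by_cases hkl : k = l
      · subst hkl
        have h0 : (fun s : ℝ => m k * m k / (σ k k * ((x k + s * w k) - (x k + s * w k)))) =
            fun _ => 0 := by
          funext s; simp
        rw [h0, show -(m k * m k * (σ k k * (w k - w k))) /
            (σ k k * ((x k + t * w k) - (x k + t * w k))) ^ 2 = 0 by simp]
        exact hasDerivAt_const t 0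
      · have hD : HasDerivAt (fun s => σ k l * ((x k + s * w k) - (x l + s * w l)))
            (σ k l * (w k - w l)) t := ((hz k).sub (hz l)).const_mul (σ k l)
        have hDne : σ k l * ((x k + t * w k) - (x l + t * w l)) ≠ 0 := (hden t ht k l hkl).ne'
        have := HasDerivAt.div (hasDerivAt_const t (m k * m l)) hD hDne
        refine this.congr_deriv ?_
        ring
    have hsum := hA.add (hB.const_mul (1 / 2))
    exact hsum
  -- the derivative vanishes where z(t) solves the equations
  have hvanish : ∀ t ∈ Icc (0:ℝ) 1, (∀ k, x k + t * w k = collForce m (fun l => x l + t * w l) k) →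
      G' t = 0 := by
    intro t ht hcc
    set z : Fin n → ℝ := fun k => x k + t * w k with hz
    have hzpos : ∀ k l, k ≠ l → 0 < σ k l * (z k - z l) := fun k l hkl => hden t ht k l hkl
    -- ρ_{kl} = σ_{kl}/(z_k - z_l)², antisymmetric
    set ρ : Fin n → Fin n → ℝ := fun k l => σ k l / (z k - z l) ^ 2 with hρ
    have hρanti : ∀ k l, ρ l k = -ρ k l := by
      intro k l
      by_cases hkl : k = l
      · subst hkl; simp [hρ]
      · simp only [hρ]; rw [hσanti k l hkl]; ring
    -- |z_k - z_l| = σ (z_k - z_l), hence the force term equals m_l ρ_{kl}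
    have habs : ∀ k l, k ≠ l → |z k - z l| = σ k l * (z k - z l) := by
      intro k l hkl
      have hp := hzpos k l hkl
      have hs : σ k l = 1 ∨ σ k l = -1 := by simp only [hσ]; split_ifs <;> simp
      rcases hs with h | h
      · rw [h, one_mul]; rw [h, one_mul] at hp; exact abs_of_pos hp
      · rw [h] at hp ⊢; rw [abs_of_neg (by linarith)]; ring
    have hforce : ∀ k l, m l * (z k - z l) / |z k - z l| ^ 3 = m l * ρ k l := by
      intro k l
      by_cases hkl : k = l
      · subst hkl; simp [hρ]
      · have hp := hzpos k l hkl
        have hzne : z k - z l ≠ 0 := by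
          intro h0; rw [h0, mul_zero] at hp; exact lt_irrefl _ hp
        have hσne : σ k l ≠ 0 := by
          intro h0; rw [h0, zero_mul] at hp; exact lt_irrefl _ hp
        have hs : σ k l = 1 ∨ σ k l = -1 := by simp only [hσ]; split_ifs <;> simp
        rw [habs k l hkl]
        simp only [hρ]
        rcases hs with h | h
        · rw [h]; field_simp
        · rw [h]; field_simp
    have hzeq : ∀ k, z k = ∑ l, m l * ρ k l := by
      intro k
      have := hcc k
      simp only [collForce] at this
      rw [show (x k + t * w k) = z k from rfl] at this
      rw [this]
      exact Finset.sum_congr rfl (fun l _ => hforce k l)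
    have hBterm : ∀ k l, -(m k * m l * (σ k l * (w k - w l))) / (σ k l * (z k - z l)) ^ 2 =
        -(m k * m l * (w k - w l)) * ρ k l := by
      intro k l
      by_cases hkl : k = l
      · subst hkl; simp [hρ]
      · have hp := hzpos k l hkl
        have hzne : z k - z l ≠ 0 := by
          intro h0; rw [h0, mul_zero] at hp; exact lt_irrefl _ hp
        have hσne : σ k l ≠ 0 := by
          intro h0; rw [h0, zero_mul] at hp; exact lt_irrefl _ hp
        have hs : σ k l = 1 ∨ σ k l = -1 := by simp only [hσ]; split_ifs <;> simp
        simp only [hρ]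
        rcases hs with h | h
        · rw [h]; field_simp
        · rw [h]; field_simp
    -- rewrite G' t as ½ Σ_k Σ_l m_k m_l ρ_{kl} (w_k + w_l), an antisymmetric sum
    have hG't : G' t = 1 / 2 * ∑ k, ∑ l, m k * m l * ρ k l * (w k + w l) := by
      simp only [hG']
      have hA : ∑ k, m k / 2 * (w k * (x k + t * w k) + (x k + t * w k) * w k) =
          ∑ k, ∑ l, m k * w k * (m l * ρ k l) := by
        refine Finset.sum_congr rfl (fun k _ => ?_)
        rw [← Finset.mul_sum, ← hzeq k]
        simp only [hz]; ring
      have hB : ∑ k, ∑ l, -(m k * m l * (σ k l * (w k - w l))) /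
            (σ k l * ((x k + t * w k) - (x l + t * w l))) ^ 2 =
          ∑ k, ∑ l, -(m k * m l * (w k - w l)) * ρ k l := by
        refine Finset.sum_congr rfl (fun k _ => Finset.sum_congr rfl (fun l _ => ?_))
        exact hBterm k l
      rw [hA, hB]
      simp only [Finset.mul_sum]
      rw [← Finset.sum_add_distrib]
      refine Finset.sum_congr rfl (fun k _ => ?_)
      rw [← Finset.sum_add_distrib]
      refine Finset.sum_congr rfl (fun l _ => ?_)
      ring
    have hS : ∑ k, ∑ l, m k * m l * ρ k l * (w k + w l) = 0 := by
      have hswap : ∑ k, ∑ l, m k * m l * ρ k l * (w k + w l) =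
          ∑ k, ∑ l, -(m k * m l * ρ k l * (w k + w l)) := by
        rw [Finset.sum_comm]
        refine Finset.sum_congr rfl (fun l _ => Finset.sum_congr rfl (fun k _ => ?_))
        rw [hρanti l k]; ring
      have : ∑ k, ∑ l, -(m k * m l * ρ k l * (w k + w l)) =
          -∑ k, ∑ l, m k * m l * ρ k l * (w k + w l) := by
        simp [Finset.sum_neg_distrib]
      linarith [hswap.trans this]
    rw [hG't, hS, mul_zero]
  -- x and y solve the equations: G'(0) = G'(1) = 0
  have h0mem : (0:ℝ) ∈ Icc (0:ℝ) 1 := by simp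
  have h1mem : (1:ℝ) ∈ Icc (0:ℝ) 1 := by simp
  have hG'0 : G' 0 = 0 := by
    refine hvanish 0 h0mem (fun k => ?_)
    have := hx.2 k
    simpa using this
  have hG'1 : G' 1 = 0 := by
    refine hvanish 1 h1mem (fun k => ?_)
    have := hy.2 k
    have e : (fun l => x l + 1 * w l) = y := by funext l; simp [hw]
    rw [e]; simpa [hw] using this
  -- strict convexity of G on [0,1]
  have hwne : ∃ k, w k ≠ 0 := by
    by_contra hall
    have hall' : ∀ k, w k = 0 := by simpa using hall
    apply hne
    funext k
    have := hall' k
    simp only [hw] at this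
    linarith
  have hP : 0 < ∑ k, m k / 2 * w k ^ 2 := by
    obtain ⟨k0, hk0⟩ := hwne
    apply Finset.sum_pos'
    · intro k _; have := hm k; positivity
    · exact ⟨k0, Finset.mem_univ _, by have := hm k0; positivity⟩
  have hconv : StrictConvexOn ℝ (Icc (0:ℝ) 1) G := by
    refine ⟨convex_Icc 0 1, ?_⟩
    intro s hs u hu hsu a b ha hb hab
    simp only [hG, smul_eq_mul]
    -- quadratic part: strict
    have hq : ∑ k, m k / 2 * ((x k + (a * s + b * u) * w k) * (x k + (a * s + b * u) * w k)) <
        a * ∑ k, m k / 2 * ((x k + s * w k) * (x k + s * w k)) +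
        b * ∑ k, m k / 2 * ((x k + u * w k) * (x k + u * w k)) := by
      have hdiff : a * ∑ k, m k / 2 * ((x k + s * w k) * (x k + s * w k)) +
          b * ∑ k, m k / 2 * ((x k + u * w k) * (x k + u * w k)) -
          ∑ k, m k / 2 * ((x k + (a * s + b * u) * w k) * (x k + (a * s + b * u) * w k)) =
          a * b * (s - u) ^ 2 * ∑ k, m k / 2 * w k ^ 2 := by
        rw [Finset.mul_sum, Finset.mul_sum, Finset.mul_sum, ← Finset.sum_add_distrib,
          ← Finset.sum_sub_distrib]
        refine Finset.sum_congr rfl (fun k _ => ?_)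
        obtain rfl : b = 1 - a := by linarith
        ring
      have hpos : 0 < a * b * (s - u) ^ 2 * ∑ k, m k / 2 * w k ^ 2 := by
        have hsu' : (s - u) ^ 2 > 0 := by
          have : s - u ≠ 0 := sub_ne_zero.mpr hsu
          positivity
        positivity
      linarith
    -- pair part: convex, termwise
    have hr : ∑ k, ∑ l, m k * m l / (σ k l * ((x k + (a * s + b * u) * w k) - (x l + (a * s + b * u) * w l))) ≤
        a * ∑ k, ∑ l, m k * m l / (σ k l * ((x k + s * w k) - (x l + s * w l))) +
        b * ∑ k, ∑ l, m k * m l / (σ k l * ((x k + u * w k) - (x l + u * w l))) := by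
      rw [Finset.mul_sum, Finset.mul_sum, ← Finset.sum_add_distrib]
      refine Finset.sum_le_sum (fun k _ => ?_)
      rw [Finset.mul_sum, Finset.mul_sum, ← Finset.sum_add_distrib]
      refine Finset.sum_le_sum (fun l _ => ?_)
      by_cases hkl : k = l
      · subst hkl; simp
      · have hp := hden s hs k l hkl
        have hr' := hden u hu k l hkl
        have heq : σ k l * ((x k + (a * s + b * u) * w k) - (x l + (a * s + b * u) * w l)) =
            a * (σ k l * ((x k + s * w k) - (x l + s * w l))) +
            b * (σ k l * ((x k + u * w k) - (x l + u * w l))) := by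
          obtain rfl : b = 1 - a := by linarith
          ring
        rw [heq]
        exact div_convex_comb_le (by have := hm k; have := hm l; positivity) hp hr' ha.le hb.le hab
    nlinarith [hq, hr]
  -- contradiction: 0 = G'(0) < slope G 0 1 < G'(1) = 0
  have hlt1 := hconv.lt_slope_of_hasDerivAt h0mem h1mem one_pos (hderiv 0 h0mem)
  have hlt2 := hconv.slope_lt_of_hasDerivAt h0mem h1mem one_pos (hderiv 1 h1mem)
  rw [hG'0] at hlt1
  rw [hG'1] at hlt2
  linarith

/-- **Moulton (1910), finiteness.** Positive masses admit finitely many collinear normalized central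
configurations (at most one per ordering of the bodies). [cite: Moulton1910, §5] -/
theorem collinearCCs_finite {m : Fin n → ℝ} (hm : ∀ k, 0 < m k) :
    {x : Fin n → ℝ | IsCollinearCC m x}.Finite := by
  let ord : (Fin n → ℝ) → (Fin n → Fin n → Bool) := fun x k l => decide (x k < x l)
  refine Set.Finite.of_finite_image (f := ord) (Set.toFinite _) ?_
  intro x hx y hy hxy
  refine moulton_unique hm hx hy (fun k l => ?_)
  have := congrFun (congrFun hxy k) l
  simpa [ord] using this

/-- A planar positive normalized central configuration ([AlbouyKaloshin2012] Definition 1) with every body on the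
`x`-axis is a collinear normalized central configuration of the abscissae. [folklore] -/
theorem isCollinearCC_of_planar {m : Fin n → ℝ} {q : Fin n → ℝ × ℝ} (hq : IsPositiveNormalizedCC m q)
    (hy : ∀ k, (q k).2 = 0) : IsCollinearCC m (fun k => (q k).1) := by
  refine ⟨fun k l hkl hx => hq.1 k l hkl (Prod.ext hx (by rw [hy k, hy l])), fun k => ?_⟩
  have h := congrArg Prod.fst (hq.2.1 k)
  rw [newtonForce_eq_sum_univ, Prod.fst_sum] at h
  simp only [collForce]
  conv_lhs => rw [h]
  refine Finset.sum_congr rfl (fun l _ => ?_)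
  have hsq : sqDist (q k) (q l) = ((q k).1 - (q l).1) ^ 2 := by
    simp only [sqDist, hy k, hy l]; ring
  rw [Prod.smul_fst, Prod.fst_sub, smul_eq_mul, hsq, Real.sqrt_sq_eq_abs]
  ring

/-- **Corollary.** For positive masses, the positive normalized central configurations of [AlbouyKaloshin2012]
Definition 1 with all bodies on the `x`-axis (the Moulton configurations in that normalization) are finite in
number. [cite: Moulton1910, §5] -/
theorem collinear_positiveNormalizedCCs_finite {m : Fin n → ℝ} (hm : ∀ k, 0 < m k) :
    {q : Fin n → ℝ × ℝ | IsPositiveNormalizedCC m q ∧ ∀ k, (q k).2 = 0}.Finite := by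
  have hfin := collinearCCs_finite hm
  refine Set.Finite.of_finite_image (f := fun q : Fin n → ℝ × ℝ => fun k => (q k).1)
    (hfin.subset ?_) ?_
  · rintro x ⟨q, ⟨hq, hy⟩, rfl⟩
    exact isCollinearCC_of_planar hq hy
  · rintro q ⟨hq, hy⟩ q' ⟨hq', hy'⟩ h
    funext k
    exact Prod.ext (by simpa using congrFun h k) (by rw [hy k, hy' k])

end Literature.Dynamics.NBody
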